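import Summits.CriticalPhenomena.PercolationContinuityZ3.Theorems.Transplant.SkelConcFaceData
import Summits.CriticalPhenomena.PercolationContinuityZ3.Theorems.Transplant.SkelKitResidues
import Summits.CriticalPhenomena.PercolationContinuityZ3.Theorems.Transplant.SkelConcRealised
import HarnessLib

/-!
# L6 (F), part 4 — the FACE OBLIGATION `Skel.FaceOblAt` at the cell geometry of record MODULO THE PER-LEVEL KIT CLAUSE, and its RUN form
# `Skel.FaceOblR` at the schedule of record `Skel.concRadiiS` with the radii REALISED along runs (generic re-typing of `BoxProdZ2ConcFace` §3
# and `BoxProdZ2ConcFaceReal`, SHEAR-SCOPE §3.9 Layer 6 (F))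

builds on p205010 (kernel theorem, internal audit signed; external expert review pending) — nothing in this file uses p205010.
Lane `prim-bschramm`, typed by the `prim-hp-8` lineage (gen 24); helper file (`--supports stmt-CriticalPhenomena-4575 --as helper`).
NEW FILE over `SkelConcFaceData` (part 3), stmt-g7's `SkelKitResidues` (`Skel.FaceOblAt/FaceOblR`) and p5-g4's `SkelConcRealised`.

* **`faceOblAt_concSG`** — scheme-parametric (`hΓ : S.Γ = Skel.cellGeomSG Φ C w₀ Λ`, `Skel.WFS C Λ`): for a valid history examining
  `x = tgt e` at anchors `(a, a')`, an onward `du`, `j + 1 ≤ K`, an observation `o`: the step `Skel.faceStepW` (part 3), the count inequality,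
  the target cube `M_{a'}(x + du)` nonempty, `Rlev + 4 ≤ 10 s`, an entrance depth `R₀ ≥ rQ_a(x), sup ρ_{a'}(x,du,·)`, an excess radius
  `R₁ ≤ rM_{a'}(x+du) − L'` at the running parameter (centre `w₀`, entrance depth `R₀ + 1`, planar diameter `50 r`), `η ≤ δc / 2`, and THE
  PER-LEVEL KIT CLAUSE of `Skel.FaceOblAt` for this step (hypothesis `hkits`, verbatim; to be discharged by the L5 kit layer — product
  `BoxProdZ2ConcKits.kitClauseQ` / `hkits_face`) ⟹ `Skel.FaceOblAt Φ S (Skel.faceDataSG Φ C w₀ Λ) Δ' δ₂ h e a a' du j o`.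
* `off_add_stepVec_le` (planar: `off (x + du) ≤ off x + 20 r`), `M_succ_nonempty_real` (target nonemptiness at a realised pair from
  `20 r + L' ≤ gap`).
* **`faceOblR_concS`** — at `Λ := Skel.concRadiiS C gap gap' E₀ L'` (`gap ≥ 1`, `gap ≥ 20 r + 2 L' + R₁ ·`, `E₀ ≥ 2`, `L' ≥ 1`) and a
  centred root (`Φ.φ w₀ = 0`): along RUN histories the anchors of the chosen edge are realised (`Skel.realised_of_choice_SG`), so with
  `g := nQ (aOf₁) x`: `rE = F(g+1) − 1`, `rM_{a'}(x+du) = F(g+1) − L' = E g + gap (E g) − L'`, `ρ ≤ E g − 2`, `rQ_{aOf₁}(x) = E g`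
  (`Skel.l1_tgt_le_nQ`); entrance depth `E g + 1`, excess radius `R₁ (E g)` ⟹ `Skel.FaceOblR Φ S (faceDataSG …) Δ' δ₂` MODULO the kit
  clauses along runs (hypothesis `hkits`).
[cite: KozmaNitzan2024, §4 p. 27 ((30)), p. 30 (Step III), Lemma 10 (p. 17), Lemma 12 (p. 24)] [cite: MartineauSevero2019, Cor. 2.2]
-/

noncomputable section

open MeasureTheory
open scoped Classical

namespace Summit.CriticalPhenomena.PercolationContinuityZ3.Theorems

namespace Transplant

namespace Skel

open Literature.Probability.Percolation Literature.Probability.LatticeModels SimpleGraph KNCells KNLevels GadgetSystem Contour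
open Literature.Probability.Percolation.KozmaNitzan
open Literature.Probability.Percolation.KozmaNitzan.Cells (oth oth_ne sgOf sgOf_sign stepVec_apply_fst stepVec_apply_oth eq_oth_of_ne oth_oth)
open Literature.Barriers.CriticalPhenomena (graphBall graphBall_finite mem_graphBall_self graphBall_mono)
open BoxProdZ2 (ConcRadiiG Erad Frad nQ nS Realised Frad_succ Frad_le_Erad)
open PlanarSkeletonConc

variable {V : Type} [DecidableEq V] [Countable V] {G : SimpleGraph V} [G.LocallyFinite] (Φ : PlanarSkeletonConc G)

/-! ## §1 `FaceOblAt` at the geometry of record, modulo the per-level kit clause -/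

section AtGeometry

variable {C : PCells} {w₀ : V} {Λ : ConcRadiiG} {S : KSchA V ℕ}
variable (hΓ : S.Γ = cellGeomSG Φ C w₀ Λ) (hΛ : WFS C Λ)
variable {h : ProbeHistory V} {e : Site 2 × MDir} (hV : S.Valid₂ G h e) {a a' : ℕ} {du : MDir} (hdu : du ∈ S.onward G h (tgt e))
variable {j : ℕ} {o : Finset (Sym2 V)}

include hΓ hΛ hV hdu

/-- **`FaceOblAt` for the cell geometry of record, modulo the per-level kit clause.**  The step is `Skel.faceStepW` (window depth
`rE_{a'}(x,du)`, region over the shrunk far rows, target `M_{a'}(x+du) ∪ Rim`, levels `[M+1, Rlev]`, source the root, support `Sx`); every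
non-kit clause is discharged by parts 1–3; the rim excess by `rim_excess_faceStepW`.
[cite: KozmaNitzan2024, §4 p. 30 (Step III), Lemma 10 (p. 17), Lemma 12 (p. 24)] -/
theorem faceOblAt_concSG (hjK : j + 1 ≤ C.K) {Δ' Rlev N M L' : ℕ} {δ₂ : ℝ} (hRlev : Rlev + 4 ≤ 10 * C.s)
    (hcount : 1 / (1 - (S.p : ℝ)) ^ (Δ' * N) ≤ δ₂ * ((Finset.Icc (M + 1) Rlev).card : ℝ))
    (hMne : (S.Γ.M a' (tgt e + stepVec du)).Nonempty)
    (hkits : let P := faceStepW Φ C w₀ Λ a' (tgt e) du j Rlev N M L' (S.Sx G h e a a' du)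
      ∀ j' ∈ Finset.Icc P.j₀ P.j₁, ∃ (σ : KNLevels.SData V) (Sz : Finset V),
        KNLevels.SHyp (winLData Φ P.root P.Rπ P.lo P.hi P.root P.Sfin) j' σ ∧ σ.N ≤ P.N ∧
        (1 - (S.p : ℝ) ^ σ.sB) ^ σ.k ≤ δ₂ ∧ Sz ⊆ (winLData Φ P.root P.Rπ P.lo P.hi P.root P.Sfin).X j' ∧ Sz ⊆ P.Rg Φ ∧
        (∀ x ∈ σ.K, ∀ e' ∈ σ.seed x, e' ∉ wireSet (↑Sz : Set V)) ∧ (∀ x ∈ σ.K, σ.face x ⊆ Sz) ∧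
        (∀ x ∈ σ.K, 1 - 3 * δ₂ ≤ (prodBernoulli (S.Wt G h e a a' du j o)).real {ω | ∃ u ∈ σ.face x,
          1 - δ₂ < (prodBernoulli (pinW (S.Wt G h e a a' du j o) (wireSet (↑Sz : Set V)) ω)).real
            (⋃ t ∈ P.T, openConnIn (↑(P.Rg Φ) : Set V) u t)}))
    {R₀ : ℕ} (hQ : Λ.rQ a (tgt e) ≤ R₀) (hρ : ∀ ℓ, Λ.ρ a' (tgt e) du ℓ ≤ R₀) {η : ℝ} (hη : η ≤ S.δc / 2) {R₁ : ℕ}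
    (hR₁ : ∀ R', R₁ ≤ R' → ∀ (Rw : ℕ) (D' A' : Finset V), (∀ d ∈ D', d ∈ graphBall G w₀ Rw) →
      (∀ d ∈ D', ∀ d' ∈ D', Φ.φ d - Φ.φ d' ∈ box 2 (50 * C.r)) → A' ⊆ D' → (∀ a ∈ A', a ∈ graphBall G w₀ (R₀ + 1)) →
        (bondPercolation G S.p).real (excess G w₀ R' D' A') ≤ η)
    (hR : R₁ ≤ Λ.rM a' (tgt e + stepVec du) - L') :
    FaceOblAt Φ S (faceDataSG Φ C w₀ Λ) Δ' δ₂ h e a a' du j o := by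
  have hexc := rim_excess_faceStepW Φ hΓ hΛ hV hdu (j := j) (o := o) Rlev N M L' hQ hρ hR₁ hR
  have hsub := isSubbox_faceStepW Φ hΓ hΛ hV hdu (a := a) (a' := a') (j := j) (o := o) Rlev N M L'
  have hRgS := faceStepW_Rg_subset_Sfin Φ hΓ hΛ (h := h) (e := e) (a := a) (a' := a') (du := du) (j := j) Rlev N M L'
  have hroot := faceStepW_root_eq Φ hΓ (h := h) (e := e) (a := a) (a' := a') (du := du) (j := j) Rlev N M L'
  have ho := root_not_mem_faceStepW_Rg Φ hΓ hΛ hV hdu (a := a) (a' := a') (j := j) Rlev N M L'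
  have hoS := root_mem_faceStepW_Sfin Φ hV (C := C) (w₀ := w₀) (Λ := Λ) (a := a) (a' := a') (du := du) (j := j) Rlev N M L'
  obtain ⟨Γ, p, δc⟩ := S
  cases hΓ
  refine ⟨faceStepW Φ C w₀ Λ a' (tgt e) du j Rlev N M L' (KSchA.Sx G ⟨cellGeomSG Φ C w₀ Λ, p, δc⟩ h e a a' du),
    (cellGeomSG Φ C w₀ Λ).M a' (tgt e + stepVec du), η, hroot, hsub, finSupp_faceStepW Φ Rlev N M L', hRgS,
    faceStepW_encl Φ C w₀ Λ a' (tgt e) du hjK hRlev N M L' _, ho, hoS, le_rfl,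
    faceStepW_T_subset_Rg Φ w₀ a' (tgt e) du Rlev N M L' _ hΛ.wf (by omega), faceStepW_T_nonempty Φ C w₀ Λ a' (tgt e) du j Rlev N M L' _ hMne,
    hcount, hkits, Finset.subset_union_left, subset_rfl, hexc, hη, ?_⟩
  exact Face_subset_faceStepW_X_zero Φ w₀ a' (tgt e) du j Rlev N M L' _ hΛ.wf

end AtGeometry

/-! ## §2 The run form at the schedule of record, radii realised -/

omit [DecidableEq V] [Countable V] [G.LocallyFinite] Φ in
/-- `off (x + du) ≤ off x + 20 r` (the centres move by `20 r` along a macro-edge). [folklore] -/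
theorem off_add_stepVec_le (C : PCells) (x : Site 2) (du : MDir) : off C (x + stepVec du) ≤ off C x + 20 * C.r := by
  have key : ∀ i, (C.cen (x + stepVec du) i).natAbs ≤ (C.cen x i).natAbs + 20 * C.r * (stepVec du i).natAbs := by
    intro i
    have h : C.cen (x + stepVec du) i = C.cen x i + 20 * (C.r : ℤ) * stepVec du i := by
      simp only [PCells.cen_apply, Pi.add_apply]; ring
    rw [h]
    refine (Int.natAbs_add_le _ _).trans ?_
    have h2 : (20 * (C.r : ℤ) * stepVec du i).natAbs = 20 * C.r * (stepVec du i).natAbs := by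
      rw [Int.natAbs_mul, Int.natAbs_mul]; simp
    rw [h2]
  have hst : (stepVec du 0).natAbs + (stepVec du 1).natAbs = 1 := by
    have hd : du.1 = 0 ∨ du.1 = 1 := by
      rcases du with ⟨i, b⟩
      fin_cases i <;> simp
    have hs : (sgOf du).natAbs = 1 := by rcases sgOf_sign du with hσ | hσ <;> simp [hσ]
    have ha : stepVec du du.1 = sgOf du := stepVec_apply_fst du
    have hb : stepVec du (oth du.1) = 0 := stepVec_apply_oth du
    rcases hd with hd | hd
    · have ho : oth du.1 = 1 := by rw [hd]; rfl
      rw [hd] at ha; rw [ho] at hb; simp [ha, hb, hs]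
    · have ho : oth du.1 = 0 := by rw [hd]; rfl
      rw [hd] at ha; rw [ho] at hb; simp [ha, hb, hs]
  unfold off
  have h0 := key 0
  have h1 := key 1
  nlinarith

section Realised

variable (C : PCells) (w₀ : V) (gap gap' : ℕ → ℕ) (E₀ L' : ℕ) (q : unitInterval) (δc : ℝ)

omit [Countable V] in
/-- **The true target of a realised pair is nonempty**: at a chosen edge with `g = nQ (aOf₁) x` and `‖x‖₁ ≤ g` (`Skel.l1_tgt_le_nQ`), the
target cube radius `rM_{a'}(x + du) = E g + gap (E g) − L'` dominates `off (x + du) ≤ E g + 20 r` once `20 r + L' ≤ gap (E g)`; then (ι) `step`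
puts a vertex over `cen (x + du)` into `M_{a'}(x + du)`. [cite: KozmaNitzan2024, §4 p. 26 ((29))] -/
theorem M_succ_nonempty_real (hgap : ∀ n, 20 * C.r ≤ gap n) (hE₀ : 1 ≤ E₀) (hφ : Φ.φ w₀ = 0) {α β : ℕ} {x : Site 2} {du : MDir}
    (hr : Realised α β x) (hy : x + stepVec du ≠ 0) (hx : (x 0).natAbs + (x 1).natAbs ≤ nQ α x)
    (hgapL : 20 * C.r + L' ≤ gap (Erad gap gap' E₀ (nQ α x))) :
    ((cellGeomSG Φ C w₀ (concRadiiS C gap gap' E₀ L')).M β (x + stepVec du)).Nonempty := by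
  refine M_nonempty_of_offset_le Φ C w₀ (x + stepVec du) ?_
  simp only [hφ, Pi.zero_apply, sub_zero]
  change off C (x + stepVec du) ≤ Frad gap gap' E₀ (nQ β (x + stepVec du)) - L'
  rw [hr.nQ_add_stepVec hy, Frad_succ]
  have h1 := off_add_stepVec_le C x du
  have h2 := off_le_Erad C gap' E₀ hgap hE₀ hx (gap := gap)
  omega

/-- **`FaceOblR` for the scheme of record at the schedule of record, modulo the kit clauses along runs.**
[cite: KozmaNitzan2024, §4 p. 30 (Step III), Lemma 10 (p. 17), Lemma 12 (p. 24)] [cite: MartineauSevero2019, Cor. 2.2] -/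
theorem faceOblR_concS (hgap : ∀ n, 1 ≤ gap n) (hgap20 : ∀ n, 20 * C.r ≤ gap n) (hE₀ : 2 ≤ E₀) (hL' : 1 ≤ L') (hφ : Φ.φ w₀ = 0)
    {Δ' Rlev N M : ℕ} {δ₂ : ℝ} (hRlev : Rlev + 4 ≤ 10 * C.s)
    (hcount : 1 / (1 - (q : ℝ)) ^ (Δ' * N) ≤ δ₂ * ((Finset.Icc (M + 1) Rlev).card : ℝ))
    {η : ℝ} (hη : η ≤ δc / 2) (R₁ : ℕ → ℕ)
    (hR₁ : ∀ ρ R', R₁ ρ ≤ R' → ∀ (Rw : ℕ) (D' A' : Finset V), (∀ d ∈ D', d ∈ graphBall G w₀ Rw) →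
      (∀ d ∈ D', ∀ d' ∈ D', Φ.φ d - Φ.φ d' ∈ box 2 (50 * C.r)) → A' ⊆ D' → (∀ a ∈ A', a ∈ graphBall G w₀ (ρ + 1)) →
        (bondPercolation G q).real (excess G w₀ R' D' A') ≤ η)
    (hgapR : ∀ ρ, 20 * C.r + 2 * L' + R₁ ρ ≤ gap ρ)
    (hkits : ∀ (h : ProbeHistory V) (e : Site 2 × MDir),
      let Λ := concRadiiS C gap gap' E₀ L'
      let S : KSchA V ℕ := ⟨cellGeomSG Φ C w₀ Λ, q, δc⟩
      S.IsRun₂ G h → (S.astOf₂ G h).st.choice = some e → S.Valid₂ G h e →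
      ∀ du ∈ S.onward G h (tgt e), ∀ j < C.K, ∀ o : Finset (Sym2 V),
      let a := S.aOf₁ G h e
      let a' := S.aOf₂ G h e
      let P := faceStepW Φ C w₀ Λ a' (tgt e) du j Rlev N M L' (S.Sx G h e a a' du)
      ∀ j' ∈ Finset.Icc P.j₀ P.j₁, ∃ (σ : KNLevels.SData V) (Sz : Finset V),
        KNLevels.SHyp (winLData Φ P.root P.Rπ P.lo P.hi P.root P.Sfin) j' σ ∧ σ.N ≤ P.N ∧
        (1 - (S.p : ℝ) ^ σ.sB) ^ σ.k ≤ δ₂ ∧ Sz ⊆ (winLData Φ P.root P.Rπ P.lo P.hi P.root P.Sfin).X j' ∧ Sz ⊆ P.Rg Φ ∧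
        (∀ x ∈ σ.K, ∀ e' ∈ σ.seed x, e' ∉ wireSet (↑Sz : Set V)) ∧ (∀ x ∈ σ.K, σ.face x ⊆ Sz) ∧
        (∀ x ∈ σ.K, 1 - 3 * δ₂ ≤ (prodBernoulli (S.Wt G h e a a' du j o)).real {ω | ∃ u ∈ σ.face x,
          1 - δ₂ < (prodBernoulli (pinW (S.Wt G h e a a' du j o) (wireSet (↑Sz : Set V)) ω)).real
            (⋃ t ∈ P.T, openConnIn (↑(P.Rg Φ) : Set V) u t)})) :
    FaceOblR Φ (⟨cellGeomSG Φ C w₀ (concRadiiS C gap gap' E₀ L'), q, δc⟩ : KSchA V ℕ)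
      (faceDataSG Φ C w₀ (concRadiiS C gap gap' E₀ L')) Δ' δ₂ := by
  intro h e hrun hc hV du hdu j hj o
  set Λ := concRadiiS C gap gap' E₀ L' with hΛdef
  set S : KSchA V ℕ := ⟨cellGeomSG Φ C w₀ Λ, q, δc⟩ with hS
  have hΛ : WFS C Λ := concRadiiS_WFS C gap gap' E₀ L' hgap hE₀ hL'
  have hr : Realised (S.aOf₁ G h e) (S.aOf₂ G h e) (tgt e) := realised_of_choice_SG h hc
  have hy : tgt e + stepVec du ≠ 0 := tgt_add_stepVec_ne_zero hφ hV hdu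
  have hE₀' : 1 ≤ E₀ := by omega
  have hxn : (tgt e 0).natAbs + (tgt e 1).natAbs ≤ nQ (S.aOf₁ G h e) (tgt e) :=
    l1_tgt_le_nQ (cellGeomSG_anchor Φ C w₀ Λ q δc) (cellGeomSG_a₀ Φ C w₀ Λ q δc) h hc
  set g := nQ (S.aOf₁ G h e) (tgt e) with hg
  obtain ⟨h1, h2, h3⟩ := hr.sched_hyps hy
  -- the realised radii
  have hrM : Λ.rM (S.aOf₂ G h e) (tgt e + stepVec du) = Erad gap gap' E₀ g + gap (Erad gap gap' E₀ g) - L' := by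
    change Frad gap gap' E₀ (nQ (S.aOf₂ G h e) (tgt e + stepVec du)) - L' = _
    rw [hr.nQ_add_stepVec hy, Frad_succ]
  have hρ : ∀ ℓ, Λ.ρ (S.aOf₂ G h e) (tgt e) du ℓ ≤ Erad gap gap' E₀ g := fun ℓ =>
    (concRadiiS_ρ_le C gap gap' E₀ L' _ _ _ ℓ).trans (by rw [hr.nS_eq]; exact Nat.sub_le _ _)
  have hQ : Λ.rQ (S.aOf₁ G h e) (tgt e) ≤ Erad gap gap' E₀ g := (concRadiiS_rQ_eq_of_norm_le C gap gap' E₀ L' hgap20 hE₀' hxn).le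
  have hgapg := hgapR (Erad gap gap' E₀ g)
  refine faceOblAt_concSG Φ (S := S) rfl hΛ hV hdu (show j + 1 ≤ C.K from hj) hRlev hcount
    (M_succ_nonempty_real Φ C w₀ gap gap' E₀ L' hgap20 hE₀' hφ hr hy hxn
      (show 20 * C.r + L' ≤ gap (Erad gap gap' E₀ g) by omega)) (hkits h e hrun hc hV du hdu j hj o) hQ hρ hη
    (hR₁ (Erad gap gap' E₀ g)) ?_
  rw [hrM]; omega

end Realised

end Skel

end Transplant

end Summit.CriticalPhenomena.PercolationContinuityZ3.Theorems

end
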